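import Summits.QuantumFields.YangMills.Theorems.UnitScaleTiltProp7LocMinOfPinnedChartSlice
import Summits.QuantumFields.YangMills.Theorems.UnitScaleTiltProp7FibrePointOfPinnedRegauge
import Summits.QuantumFields.YangMills.Theorems.UnitScaleTiltProp7SliceOfCorrectorRows
import HarnessLib

/-!
# Route `UnitScaleTilt`, crux K1 child «MinimiserStabilityRegPr» (stmt-QuantumFields-19200) — THE (α′) KNIT, DOOR-FIRST:
# E′ ⇐ per competitor: an untwisted fibre point `X` with the competitor's action and an `aℓ⁻¹` chart, a PINNED corrector `u` with covariant difference `≤ cℓ⁻¹`,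
# and for the chart `D` of `X^u` a split `D = A + R` with the rows (P-cov3) `DIV(A) ≤ ζ₁K(A) + θ₁ℓ⁻²M(D)`, (P-bch-div) `DIV(R) ≤ ζ₂K(D) + θ₂ℓ⁻²M(D)`, `K(R) ≤ ζ₃K(D) + θ₃ℓ⁻²M(D)`

Cell `ym3-torus` ∕ fleet seat `ym-ust-19200-p1` (gen 14, route-R lead ∕ (n3) namer).  THEOREMS ONLY (0 `def`, 0 `sorry`); `--supports stmt-QuantumFields-19200`, count-neutral.
YM₃ on T³ is a ladder rung (R3), not the Clay problem; nothing here claims the stub, the crux, d = 4 or the mass gap; E′ is NOT closed by this file.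

WHY (KNIT-ALPHA-PRIME-g14.md).  This is STEP 5 of the (α′) knit with STEPS 3–4 discharged by kernel (✓`Prop7FibrePointOfPinnedRegauge.fibrePoint_rows_of_pinned_regauge`,
✓`Prop7SliceOfCorrectorRows.K_sub_le`∕`DIV_add_le`) and the remaining analytic content DISPLAYED in the letters its suppliers must produce: STEP 1 (`X`: ✓`Prop7UntwistChartOfTwist`
from the Thm-2 datum), STEP 2 (`u = e^{−Iψ}`, the centre-harmonic corrector: sup rows ✓`Prop7CentreHarmonicRegaugeSupCov` ⟸ (hK)), STEP 4's two analytic rows — (P-cov3) the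
CURVED ζ-row on the corrector's output `A = A_H` (flat ✓`Prop7CentreHarmonicDivEngine`∕`…Dictionary`), (P-bch-div) the divergence of the BCH remainder `R = R₂`
(✓`Prop7PinnedRegaugeChartBCH`∕`…BCHRemainderLipschitz`∕`…ChartLipschitz`).  The door constants are `sQ := a + c`, `ζ := 4ζ₁(1+ζ₃) + 2ζ₂`, `δ₁ := 4ζ₁θ₃ + 2θ₁ + 2θ₂`
(all L-only), windows those of ✓`stub_PV3E_of_fibrePointSlice` written in these letters.

WHAT IS PROVED (ns `…Theorems.Prop7PV3EOfCorrectorRows`): ★★★ `stub_PV3E_of_correctorRows`.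
HONEST SCOPE.  Bookkeeping over landed theorems; the displayed per-competitor rows are the open analytic content of path (α′) (pens named on the cell bus 2026-08-28).

References: T. Bałaban, CMP 102 (1985) 277–309 [Balaban1985Variational] ((4)–(7) p.278, (14)–(15) p.280, (47)–(48) pp.285–286, (116) p.295, (141)–(143), Prop. 7 p.299);
CMP 99 (1985) 389–434 [Balaban1985BackgroundPropagators] ((3.8)–(3.11) p.392); CMP 98 (1985) 17–51 [Balaban1985Averaging] ((11) p.19, (19)–(21) p.21).
-/

set_option autoImplicit false
noncomputable section

open scoped BigOperators Matrix.Norms.L2Operator Matrix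

namespace Summit.QuantumFields.YangMills.Theorems.Prop7PV3EOfCorrectorRows

open Literature.MathematicalPhysics.QuantumFieldTheory.Balaban1983to89
open Literature.MathematicalPhysics.QuantumFieldTheory.Balaban1983to89.T3ContinuumYM3Torus
open Literature.MathematicalPhysics.QuantumFieldTheory.Balaban1983to89.T3Thm1Carrier
open Literature.MathematicalPhysics.QuantumFieldTheory.Balaban1983to89.T3PrintedRegularMinimiser
open Literature.MathematicalPhysics.QuantumFieldTheory.Balaban1983to89.T3RegularMinimiser
open Literature.MathematicalPhysics.QuantumFieldTheory.Balaban1983to89.T3Thm1CarrierNative (IsCritR2)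
open Literature.MathematicalPhysics.QuantumFieldTheory.Balaban1983to89.T3SectALandauChart (CloseAvg)
open Literature.MathematicalPhysics.QuantumFieldTheory.Balaban1983to89.T3PrintedRegularOrbits (descTransf)
open T4Continuum
open MatrixLog (mlog)
open B9Eq39Adjoint (divB)
open B10Eq27TorusAxialLog (unitsField toUField)
open B9TorusCalculus (torusT)
open BlockAveragingEMLLinearisedBackground (pertVar)
open Summit.QuantumFields.YangMills.Theorems.Prop7LocMinOfPinnedChartSlice (stub_PV3E_of_fibrePointSlice)
open Summit.QuantumFields.YangMills.Theorems.Prop7FibrePointOfPinnedRegauge (fibrePoint_rows_of_pinned_regauge)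
open Summit.QuantumFields.YangMills.Theorems.Prop7SliceOfCorrectorRows (K_sub_le DIV_add_le)

set_option maxHeartbeats 800000 in
/-- ★★★ **THE (α′) KNIT, DOOR-FIRST.**  For every `L > 1` L-only constants `e₆ > 0`, `a, c ≥ 0` (sup of the untwisted chart ∕ of the corrector's covariant difference),
`ζ₁ ζ₂ ζ₃ θ₁ θ₂ θ₃ ≥ 0` with the windows of ✓`stub_PV3E_of_fibrePointSlice` at `sQ := a + c`, `ζ := 4ζ₁(1+ζ₃) + 2ζ₂`, `δ₁ := 4ζ₁θ₃ + 2θ₁ + 2θ₂`, such that at every member,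
radius `0 < e ≤ e₆`, datum `V`, R2-critical `W ∈ (6)(e) ∩ 𝔅_k(V)`, EVERY competitor `W′ ∈ (6)(e) ∩ 𝔅_k(V)` has: an untwisted fibre point `X ∈ (6)(e) ∩ 𝔅_k(V)` with `A(W′) = A(X)`
and `‖X_bW_b⁻¹ − 1‖ ≤ aℓ⁻¹`; a PINNED `u` with `‖u(b₋) − W_b u(b₊) W_b*‖ ≤ cℓ⁻¹`; and for `D = −i log((X^u)_bW_b⁻¹)` fields `A, R` with `D = A + R`,
`DIV_W(A) ≤ ζ₁K_W(A) + θ₁ℓ⁻²Σ‖D‖²`, `DIV_W(R) ≤ ζ₂K_W(D) + θ₂ℓ⁻²Σ‖D‖²`, `K_W(R) ≤ ζ₃K_W(D) + θ₃ℓ⁻²Σ‖D‖²`.  CONCLUSION = the E′ text verbatim.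
[cite: Balaban1985Variational, (141)-(143) p.299, Prop. 7 p.299, (4)-(7) p.278, (14)-(15) p.280, (47)-(48) pp.285-286, (116) p.295; Balaban1985BackgroundPropagators, (3.8)-(3.11) p.392; Balaban1985Averaging, (11) p.19, (19)-(21) p.21] -/
theorem stub_PV3E_of_correctorRows
    (hrowsU : ∀ (L : ℕ), 1 < L → ∃ e₆ a c ζ₁ ζ₂ ζ₃ θ₁ θ₂ θ₃ : ℝ, 0 < e₆ ∧ 100000000000000 * (L : ℝ) ^ 9 * e₆ ≤ 1 ∧ 0 ≤ a ∧ 0 ≤ c ∧ 8 * (a + c) ≤ 1 ∧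
      800000000000 * (L : ℝ) ^ 9 * (a + c) ≤ 1 ∧ 0 ≤ ζ₁ ∧ 0 ≤ ζ₂ ∧ 0 ≤ ζ₃ ∧ 0 ≤ θ₁ ∧ 0 ≤ θ₂ ∧ 0 ≤ θ₃ ∧ (4 * ζ₁ * θ₃ + 2 * θ₁ + 2 * θ₂) < 4 * (1 / (128 * (18 + 537600 * (L : ℝ) ^ 4))) ∧
      16 * e₆ * ((8 * ((3 / 2) * (694800 * (L : ℝ) ^ 5) * (28800 * (L : ℝ) ^ 4) * ((L : ℝ) ^ 2 / ((L : ℝ) ^ 3 - 1)))) * (1 + (4 * ζ₁ * (1 + ζ₃) + 2 * ζ₂))) ≤ 1 ∧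
      15552 * (2 * (a + c)) ^ 2 + 216 * e₆ + 2 * e₆ * ((2 * ((3 / 2) * (694800 * (L : ℝ) ^ 5) * (7 * ((L : ℝ) ^ 2 / ((L : ℝ) - 1)) + 600000 * (L : ℝ) ^ 4 * ((L : ℝ) ^ 2 / ((L : ℝ) ^ 3 - 1)))) + 322608 * ((3 / 2) * (694800 * (L : ℝ) ^ 5) * (28800 * (L : ℝ) ^ 4) * ((L : ℝ) ^ 2 / ((L : ℝ) ^ 3 - 1))))
        + (8 * ((3 / 2) * (694800 * (L : ℝ) ^ 5) * (28800 * (L : ℝ) ^ 4) * ((L : ℝ) ^ 2 / ((L : ℝ) ^ 3 - 1)))) * (4 * ζ₁ * θ₃ + 2 * θ₁ + 2 * θ₂))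
        ≤ (((1 / (128 * (18 + 537600 * (L : ℝ) ^ 4))) - (4 * ζ₁ * θ₃ + 2 * θ₁ + 2 * θ₂) / 4) / (1 + (4 * ζ₁ * (1 + ζ₃) + 2 * ζ₂) / 4)) / 8 ∧
      ∀ (F : T3Family), F.L = L → ∀ (n K : ℕ) (hnK : n < K) (e : ℝ) (V : GaugeField (F.P n) 0 (Matrix.specialUnitaryGroup (Fin 2) ℂ))
        (W : GaugeField (F.P K) 0 (Matrix.specialUnitaryGroup (Fin 2) ℂ)),
        0 < e → e ≤ e₆ → W ∈ regFibrePr F n K hnK.le e V → IsCritR2 F n K hnK.le V W →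
        ∀ W' : GaugeField (F.P K) 0 (Matrix.specialUnitaryGroup (Fin 2) ℂ), W' ∈ regFibrePr F n K hnK.le e V →
          ∃ (X : GaugeField (F.P K) 0 (Matrix.specialUnitaryGroup (Fin 2) ℂ)) (u : GaugeTransf (F.P K) 0 (Matrix.specialUnitaryGroup (Fin 2) ℂ)),
            X ∈ regFibrePr F n K hnK.le e V ∧ wilsonAction4 W' = wilsonAction4 X ∧ descTransf F n K hnK.le u = (fun _ => 1) ∧
            (∀ b : PBond (F.P K) 0, ‖pertVar W X b‖ ≤ a * ((F.L : ℝ) ^ (K - n))⁻¹) ∧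
            (∀ b : PBond (F.P K) 0, ‖((u b.src : Matrix.specialUnitaryGroup (Fin 2) ℂ) : Matrix (Fin 2) (Fin 2) ℂ)
                - ((W b : Matrix.specialUnitaryGroup (Fin 2) ℂ) : Matrix (Fin 2) (Fin 2) ℂ) * ((u b.tgt : Matrix.specialUnitaryGroup (Fin 2) ℂ) : Matrix (Fin 2) (Fin 2) ℂ)
                    * star ((W b : Matrix.specialUnitaryGroup (Fin 2) ℂ) : Matrix (Fin 2) (Fin 2) ℂ)‖ ≤ c * ((F.L : ℝ) ^ (K - n))⁻¹) ∧
            ∀ D : PBond (F.P K) 0 → Matrix (Fin 2) (Fin 2) ℂ,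
              D = (fun b => (-Complex.I) • mlog ((GaugeField.gaugeAct u X b * (W b)⁻¹ : Matrix.specialUnitaryGroup (Fin 2) ℂ) : Matrix (Fin 2) (Fin 2) ℂ)) →
              ∃ A R : PBond (F.P K) 0 → Matrix (Fin 2) (Fin 2) ℂ, (∀ b, D b = A b + R b) ∧
                (∑ x : Site (F.P K) 0, ∑ j : Fin 2, ∑ k : Fin 2,
            ‖(divB (torusT (F.P K) 0) (fun κ z => unitsField (toUField W) ⟨z, κ⟩) (fun κ z => Complex.I • A ⟨z, κ⟩) x) j k‖ ^ 2)
                  ≤ ζ₁ * (∑ p : Plaq (F.P K) 0, ‖((Complex.I • A ⟨p.src, p.μ⟩) + ((W ⟨p.src, p.μ⟩ : Matrix (Fin 2) (Fin 2) ℂ) * (Complex.I • A ⟨p.src.shift p.μ, p.ν⟩) * star (W ⟨p.src, p.μ⟩ : Matrix (Fin 2) (Fin 2) ℂ))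
            - (((W ⟨p.src, p.μ⟩ * W ⟨p.src.shift p.μ, p.ν⟩ * (W ⟨p.src.shift p.ν, p.μ⟩)⁻¹ : Matrix.specialUnitaryGroup (Fin 2) ℂ) : Matrix (Fin 2) (Fin 2) ℂ) * (Complex.I • A ⟨p.src.shift p.ν, p.μ⟩) * star ((W ⟨p.src, p.μ⟩ * W ⟨p.src.shift p.μ, p.ν⟩ * (W ⟨p.src.shift p.ν, p.μ⟩)⁻¹ : Matrix.specialUnitaryGroup (Fin 2) ℂ) : Matrix (Fin 2) (Fin 2) ℂ))
            - (((GaugeField.plaqHol W p : Matrix.specialUnitaryGroup (Fin 2) ℂ) : Matrix (Fin 2) (Fin 2) ℂ) * (Complex.I • A ⟨p.src, p.ν⟩) * star ((GaugeField.plaqHol W p : Matrix.specialUnitaryGroup (Fin 2) ℂ) : Matrix (Fin 2) (Fin 2) ℂ)))‖ ^ 2) + θ₁ * (((F.L : ℝ) ^ (K - n)) ^ 2)⁻¹ * ∑ b : PBond (F.P K) 0, ‖D b‖ ^ 2 ∧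
                (∑ x : Site (F.P K) 0, ∑ j : Fin 2, ∑ k : Fin 2,
            ‖(divB (torusT (F.P K) 0) (fun κ z => unitsField (toUField W) ⟨z, κ⟩) (fun κ z => Complex.I • R ⟨z, κ⟩) x) j k‖ ^ 2)
                  ≤ ζ₂ * (∑ p : Plaq (F.P K) 0, ‖((Complex.I • D ⟨p.src, p.μ⟩) + ((W ⟨p.src, p.μ⟩ : Matrix (Fin 2) (Fin 2) ℂ) * (Complex.I • D ⟨p.src.shift p.μ, p.ν⟩) * star (W ⟨p.src, p.μ⟩ : Matrix (Fin 2) (Fin 2) ℂ))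
            - (((W ⟨p.src, p.μ⟩ * W ⟨p.src.shift p.μ, p.ν⟩ * (W ⟨p.src.shift p.ν, p.μ⟩)⁻¹ : Matrix.specialUnitaryGroup (Fin 2) ℂ) : Matrix (Fin 2) (Fin 2) ℂ) * (Complex.I • D ⟨p.src.shift p.ν, p.μ⟩) * star ((W ⟨p.src, p.μ⟩ * W ⟨p.src.shift p.μ, p.ν⟩ * (W ⟨p.src.shift p.ν, p.μ⟩)⁻¹ : Matrix.specialUnitaryGroup (Fin 2) ℂ) : Matrix (Fin 2) (Fin 2) ℂ))
            - (((GaugeField.plaqHol W p : Matrix.specialUnitaryGroup (Fin 2) ℂ) : Matrix (Fin 2) (Fin 2) ℂ) * (Complex.I • D ⟨p.src, p.ν⟩) * star ((GaugeField.plaqHol W p : Matrix.specialUnitaryGroup (Fin 2) ℂ) : Matrix (Fin 2) (Fin 2) ℂ)))‖ ^ 2) + θ₂ * (((F.L : ℝ) ^ (K - n)) ^ 2)⁻¹ * ∑ b : PBond (F.P K) 0, ‖D b‖ ^ 2 ∧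
                (∑ p : Plaq (F.P K) 0, ‖((Complex.I • R ⟨p.src, p.μ⟩) + ((W ⟨p.src, p.μ⟩ : Matrix (Fin 2) (Fin 2) ℂ) * (Complex.I • R ⟨p.src.shift p.μ, p.ν⟩) * star (W ⟨p.src, p.μ⟩ : Matrix (Fin 2) (Fin 2) ℂ))
            - (((W ⟨p.src, p.μ⟩ * W ⟨p.src.shift p.μ, p.ν⟩ * (W ⟨p.src.shift p.ν, p.μ⟩)⁻¹ : Matrix.specialUnitaryGroup (Fin 2) ℂ) : Matrix (Fin 2) (Fin 2) ℂ) * (Complex.I • R ⟨p.src.shift p.ν, p.μ⟩) * star ((W ⟨p.src, p.μ⟩ * W ⟨p.src.shift p.μ, p.ν⟩ * (W ⟨p.src.shift p.ν, p.μ⟩)⁻¹ : Matrix.specialUnitaryGroup (Fin 2) ℂ) : Matrix (Fin 2) (Fin 2) ℂ))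
            - (((GaugeField.plaqHol W p : Matrix.specialUnitaryGroup (Fin 2) ℂ) : Matrix (Fin 2) (Fin 2) ℂ) * (Complex.I • R ⟨p.src, p.ν⟩) * star ((GaugeField.plaqHol W p : Matrix.specialUnitaryGroup (Fin 2) ℂ) : Matrix (Fin 2) (Fin 2) ℂ)))‖ ^ 2)
                  ≤ ζ₃ * (∑ p : Plaq (F.P K) 0, ‖((Complex.I • D ⟨p.src, p.μ⟩) + ((W ⟨p.src, p.μ⟩ : Matrix (Fin 2) (Fin 2) ℂ) * (Complex.I • D ⟨p.src.shift p.μ, p.ν⟩) * star (W ⟨p.src, p.μ⟩ : Matrix (Fin 2) (Fin 2) ℂ))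
            - (((W ⟨p.src, p.μ⟩ * W ⟨p.src.shift p.μ, p.ν⟩ * (W ⟨p.src.shift p.ν, p.μ⟩)⁻¹ : Matrix.specialUnitaryGroup (Fin 2) ℂ) : Matrix (Fin 2) (Fin 2) ℂ) * (Complex.I • D ⟨p.src.shift p.ν, p.μ⟩) * star ((W ⟨p.src, p.μ⟩ * W ⟨p.src.shift p.μ, p.ν⟩ * (W ⟨p.src.shift p.ν, p.μ⟩)⁻¹ : Matrix.specialUnitaryGroup (Fin 2) ℂ) : Matrix (Fin 2) (Fin 2) ℂ))
            - (((GaugeField.plaqHol W p : Matrix.specialUnitaryGroup (Fin 2) ℂ) : Matrix (Fin 2) (Fin 2) ℂ) * (Complex.I • D ⟨p.src, p.ν⟩) * star ((GaugeField.plaqHol W p : Matrix.specialUnitaryGroup (Fin 2) ℂ) : Matrix (Fin 2) (Fin 2) ℂ)))‖ ^ 2) + θ₃ * (((F.L : ℝ) ^ (K - n)) ^ 2)⁻¹ * ∑ b : PBond (F.P K) 0, ‖D b‖ ^ 2) :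
    ∀ (L : ℕ), 1 < L → ∀ (B₃ : ℝ), 4 < B₃ →
    ∃ e₅ a₁'' : ℝ, 0 < e₅ ∧ 0 < a₁'' ∧ ∀ (i : Idx L) (e ε₁ : ℝ) (V : GaugeField (i.1.1.P i.1.2.1) 0 (Matrix.specialUnitaryGroup (Fin 2) ℂ))
      (U₀ W : GaugeField (i.1.1.P i.1.2.2) 0 (Matrix.specialUnitaryGroup (Fin 2) ℂ)),
      0 < ε₁ → ε₁ ≤ a₁'' → PlaqSmall ε₁ V → (L : ℝ) ^ 3 * B₃ * ε₁ ≤ e → e ≤ e₅ →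
      RegPr i.1.1 i.1.2.1 i.1.2.2 ((L : ℝ) ^ 3 * B₃ * ε₁) U₀ → CloseAvg i.1.1 i.1.2.1 i.1.2.2 i.2.2.le ((L : ℝ) ^ 3 * ε₁) V U₀ →
      W ∈ regFibrePr i.1.1 i.1.2.1 i.1.2.2 i.2.2.le e V → IsCritR2 i.1.1 i.1.2.1 i.1.2.2 i.2.2.le V W →
        IsMinOn (fun W' : GaugeField (i.1.1.P i.1.2.2) 0 (Matrix.specialUnitaryGroup (Fin 2) ℂ) => wilsonAction4 W')
          (regFibrePr i.1.1 i.1.2.1 i.1.2.2 i.2.2.le e V) W := by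
  intro L hL B₃ hB₃
  refine stub_PV3E_of_fibrePointSlice ?_ L hL B₃ hB₃
  intro L' hL'
  obtain ⟨e₆, a, c, ζ₁, ζ₂, ζ₃, θ₁, θ₂, θ₃, he₆, he₆L, ha, hc, hsQ8, hsQL, hζ₁, hζ₂, hζ₃, hθ₁, hθ₂, hθ₃, hδκ, hC₂e, hsmall, H⟩ := hrowsU L' hL'
  refine ⟨e₆, a + c, 4 * ζ₁ * (1 + ζ₃) + 2 * ζ₂, 4 * ζ₁ * θ₃ + 2 * θ₁ + 2 * θ₂, he₆, he₆L, by positivity, hsQ8, hsQL, by positivity, by positivity, hδκ,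
    hC₂e, hsmall, ?_⟩
  intro F hF n K hnK e V W he hhi hW hWcrit W' hW'
  obtain ⟨X, u, hX, hAX, hu, hsupX, hcorr, hrows⟩ := H F hF n K hnK e V W he hhi hW hWcrit W' hW'
  obtain ⟨hYmem, hAY, hsupY⟩ := fibrePoint_rows_of_pinned_regauge F hnK.le he.le W W' X hX hAX u hu hsupX hcorr
  refine ⟨GaugeField.gaugeAct u X, hYmem, hAY, fun b => by rw [add_mul]; exact hsupY b, fun D hD => ?_⟩
  obtain ⟨A, R, hDAR, hA, hR, hRK⟩ := hrows D hD
  set ℓ2i : ℝ := (((F.L : ℝ) ^ (K - n)) ^ 2)⁻¹ with hℓ2i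
  set Mm : ℝ := ∑ b : PBond (F.P K) 0, ‖D b‖ ^ 2 with hMm
  set KD : ℝ := ∑ p : Plaq (F.P K) 0, ‖((Complex.I • D ⟨p.src, p.μ⟩) + ((W ⟨p.src, p.μ⟩ : Matrix (Fin 2) (Fin 2) ℂ) * (Complex.I • D ⟨p.src.shift p.μ, p.ν⟩) * star (W ⟨p.src, p.μ⟩ : Matrix (Fin 2) (Fin 2) ℂ))
            - (((W ⟨p.src, p.μ⟩ * W ⟨p.src.shift p.μ, p.ν⟩ * (W ⟨p.src.shift p.ν, p.μ⟩)⁻¹ : Matrix.specialUnitaryGroup (Fin 2) ℂ) : Matrix (Fin 2) (Fin 2) ℂ) * (Complex.I • D ⟨p.src.shift p.ν, p.μ⟩) * star ((W ⟨p.src, p.μ⟩ * W ⟨p.src.shift p.μ, p.ν⟩ * (W ⟨p.src.shift p.ν, p.μ⟩)⁻¹ : Matrix.specialUnitaryGroup (Fin 2) ℂ) : Matrix (Fin 2) (Fin 2) ℂ))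
            - (((GaugeField.plaqHol W p : Matrix.specialUnitaryGroup (Fin 2) ℂ) : Matrix (Fin 2) (Fin 2) ℂ) * (Complex.I • D ⟨p.src, p.ν⟩) * star ((GaugeField.plaqHol W p : Matrix.specialUnitaryGroup (Fin 2) ℂ) : Matrix (Fin 2) (Fin 2) ℂ)))‖ ^ 2 with hKD
  set KA : ℝ := ∑ p : Plaq (F.P K) 0, ‖((Complex.I • A ⟨p.src, p.μ⟩) + ((W ⟨p.src, p.μ⟩ : Matrix (Fin 2) (Fin 2) ℂ) * (Complex.I • A ⟨p.src.shift p.μ, p.ν⟩) * star (W ⟨p.src, p.μ⟩ : Matrix (Fin 2) (Fin 2) ℂ))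
            - (((W ⟨p.src, p.μ⟩ * W ⟨p.src.shift p.μ, p.ν⟩ * (W ⟨p.src.shift p.ν, p.μ⟩)⁻¹ : Matrix.specialUnitaryGroup (Fin 2) ℂ) : Matrix (Fin 2) (Fin 2) ℂ) * (Complex.I • A ⟨p.src.shift p.ν, p.μ⟩) * star ((W ⟨p.src, p.μ⟩ * W ⟨p.src.shift p.μ, p.ν⟩ * (W ⟨p.src.shift p.ν, p.μ⟩)⁻¹ : Matrix.specialUnitaryGroup (Fin 2) ℂ) : Matrix (Fin 2) (Fin 2) ℂ))
            - (((GaugeField.plaqHol W p : Matrix.specialUnitaryGroup (Fin 2) ℂ) : Matrix (Fin 2) (Fin 2) ℂ) * (Complex.I • A ⟨p.src, p.ν⟩) * star ((GaugeField.plaqHol W p : Matrix.specialUnitaryGroup (Fin 2) ℂ) : Matrix (Fin 2) (Fin 2) ℂ)))‖ ^ 2 with hKA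
  set KR : ℝ := ∑ p : Plaq (F.P K) 0, ‖((Complex.I • R ⟨p.src, p.μ⟩) + ((W ⟨p.src, p.μ⟩ : Matrix (Fin 2) (Fin 2) ℂ) * (Complex.I • R ⟨p.src.shift p.μ, p.ν⟩) * star (W ⟨p.src, p.μ⟩ : Matrix (Fin 2) (Fin 2) ℂ))
            - (((W ⟨p.src, p.μ⟩ * W ⟨p.src.shift p.μ, p.ν⟩ * (W ⟨p.src.shift p.ν, p.μ⟩)⁻¹ : Matrix.specialUnitaryGroup (Fin 2) ℂ) : Matrix (Fin 2) (Fin 2) ℂ) * (Complex.I • R ⟨p.src.shift p.ν, p.μ⟩) * star ((W ⟨p.src, p.μ⟩ * W ⟨p.src.shift p.μ, p.ν⟩ * (W ⟨p.src.shift p.ν, p.μ⟩)⁻¹ : Matrix.specialUnitaryGroup (Fin 2) ℂ) : Matrix (Fin 2) (Fin 2) ℂ))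
            - (((GaugeField.plaqHol W p : Matrix.specialUnitaryGroup (Fin 2) ℂ) : Matrix (Fin 2) (Fin 2) ℂ) * (Complex.I • R ⟨p.src, p.ν⟩) * star ((GaugeField.plaqHol W p : Matrix.specialUnitaryGroup (Fin 2) ℂ) : Matrix (Fin 2) (Fin 2) ℂ)))‖ ^ 2 with hKR
  set DD : ℝ := ∑ x : Site (F.P K) 0, ∑ j : Fin 2, ∑ k : Fin 2,
            ‖(divB (torusT (F.P K) 0) (fun κ z => unitsField (toUField W) ⟨z, κ⟩) (fun κ z => Complex.I • D ⟨z, κ⟩) x) j k‖ ^ 2 with hDD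
  set DA : ℝ := ∑ x : Site (F.P K) 0, ∑ j : Fin 2, ∑ k : Fin 2,
            ‖(divB (torusT (F.P K) 0) (fun κ z => unitsField (toUField W) ⟨z, κ⟩) (fun κ z => Complex.I • A ⟨z, κ⟩) x) j k‖ ^ 2 with hDA
  set DR : ℝ := ∑ x : Site (F.P K) 0, ∑ j : Fin 2, ∑ k : Fin 2,
            ‖(divB (torusT (F.P K) 0) (fun κ z => unitsField (toUField W) ⟨z, κ⟩) (fun κ z => Complex.I • R ⟨z, κ⟩) x) j k‖ ^ 2 with hDR
  have hKAle : KA ≤ 2 * KD + 2 * KR := K_sub_le F W D A R hDAR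
  have hDIV : DD ≤ 2 * DA + 2 * DR := DIV_add_le F W D A R hDAR
  have hKD0 : 0 ≤ KD := Finset.sum_nonneg fun _ _ => sq_nonneg _
  have hMm0 : 0 ≤ Mm := Finset.sum_nonneg fun _ _ => sq_nonneg _
  have hℓ0 : 0 ≤ ℓ2i := by positivity
  have h1 : ζ₁ * KA ≤ ζ₁ * (2 * KD + 2 * (ζ₃ * KD + θ₃ * ℓ2i * Mm)) :=
    mul_le_mul_of_nonneg_left (by linarith [hRK]) hζ₁
  have e1 : (4 * ζ₁ * (1 + ζ₃) + 2 * ζ₂) * KD + (4 * ζ₁ * θ₃ + 2 * θ₁ + 2 * θ₂) * ℓ2i * Mm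
      = 2 * (ζ₁ * (2 * KD + 2 * (ζ₃ * KD + θ₃ * ℓ2i * Mm)) + θ₁ * ℓ2i * Mm) + 2 * (ζ₂ * KD + θ₂ * ℓ2i * Mm) := by ring
  rw [e1]
  linarith [hDIV, hA, hR, h1]

end Summit.QuantumFields.YangMills.Theorems.Prop7PV3EOfCorrectorRows

end
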